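import Literature.NumberTheory.Automorphic.GKModulesDixmierSchur              -- ★ `exists_eq_algebraMap_of_comm'`, `upqCasimirOp_eq_algebraMap_of_isIrreducibleGK` (Schur, no admissibility)
import Literature.RepresentationTheory.BorelWallach2000.UpqDeterminantCharacter -- ★ `upqDetCharLie`, `upqDetChar_casimir`, `upqDetCharCasimirScalar_eq` (the `det^m` family)
import Literature.RepresentationTheory.BorelWallach2000.GKCohomologyCentralCharacter -- ★ p849137 (b1): `upq_lie_eq_zero∕upq_Ad_eq_self_of_coe_eq_smul_one`, `upqTypeClasses_eq_bot_of_center_eq_smul`, `upqTypeClasses_eq_bot_of_upqCasimirOp_eq_smul`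
import Literature.Algebra.Lie.CasimirElement                                    -- ★ `sum_apply_dualBasis_smul_basis` (dual-basis expansion)
import Summits.HodgeConjecture.HodgeConjecture.Theorems.F0P2aL2cEngineDictionary  -- ★ `I_smul_one_mem_lie` (`i·1 ∈ 𝔲(α,β)`) — REUSED, not restated
import HarnessLib

/-!
# Brick «Wχ» + «Cχ» for the LH1 re-cut of PIN-ι (χ-currency): SCHUR read-backs for the Casimir and the centre, the χ-PACKAGE
# («cohomology ⇒ Casimir scalar 0 and central scalar 0»), and the CALIBRATION of the tree's `upqCasimirOp` ∕ `σ𝔤(i·1)` on `det^m`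

Cell `hodgecm-mathlib`, half A line LH1 (closer stub `stub_S2sharp` = ★ `Rogawski1990.cohDiscrete_memXiFamily_archPinned`, item h413 =
`stmt-HodgeConjecture-24833`); DEALS (i) «Wχ» 04:13:36Z and #2 (i) «Wχ re-scoped + Cχ» 04:25:15Z of LH1-plan (g4) to LH1-p01 (g3), desk ruling
D62-pre «χ» (c4) (calibration) ∕ (c8).  PROOF lane: theorems only (no `def`, no instance, no notation, no named fact, no `sorry`); general
`U(α, β) = uFormGroup α β` (`α β : Type`, the universe of the reused ★ `I_smul_one_mem_lie`), instances at `U(2,1) = uFormGroup (Fin 2) (Fin 1)`.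

WHY.  LH1-plan (g4)'s census («PIN-ι needs NO MODELS»): the print road of the organ PIN-ι of `Cruxes/H413/Lines/F0_P3c_S2SharpPaydown.lean` is
[`P_ι ∈ Π(ξ_ι)`: Rogawski Thm. 13.3.5 + 14.6.4] + [the members of `Π(ξ_ι)` have the infinitesimal character of `φ = (a,b,c) = rogTriple p q t`:
§12.2–12.3] + [WIGNER: `H¹(𝔤, K; M) ≠ 0 ⇒` infinitesimal character `= ρ`: Prop. 15.2.1, BW VI 4.11, I §5.3]; the Wigner third is paid IN-HOUSE
in «χ-currency» — the trace-form Casimir scalar `κ = a²+b²+c²−2` (★ `upqCasimirOp`) and the central scalar `s·i`, `s = ±(a+b+c)`, of `i·1`.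
The VANISHING half (W1∕W2: a non-zero `κ` or `s` kills every ★ `upqTypeClasses`) is LH1-p02 (g2)'s ★-pending Literature file
`BorelWallach2000/GKCohomologyCentralCharacter` (★ p849137, «(b1)»; one home per statement — imported, NOT restated).  THIS file:

* §1 (W3) SCHUR READ-BACKS on an IRREDUCIBLE `(𝔤, K)`-module of `U(α,β)` (★ Dixmier–Schur `exists_eq_algebraMap_of_comm'`, NO admissibility):
  a scalar element `Z` (`↑Z = a • 1`) acts by a scalar — **`wχ_exists_central_eq_algebraMap`**, **`wχ_exists_central_scalar`** — and so does
  the Casimir — **`wχ_exists_casimir_scalar`** (★ `upqCasimirOp_eq_algebraMap_of_isIrreducibleGK`, pointwise form);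
* §2 (W4) THE χ-PACKAGE **`wχ_casimir_and_central_eq_zero_of_typeClasses_ne_bot`**: irreducible + some `upqTypeClasses … n δ ≠ ⊥` ⇒
  `(∀ v, upqCasimirOp ρ𝔤 v = 0) ∧ ∀ Z a, ↑Z = a • 1 → ∀ v, ρ𝔤 Z v = 0`; the scalar form **`wχ_scalars_eq_zero_of_typeClasses_ne_bot`**
  (`C_V = κ·id`, `ρ𝔤 Z = σ·id`, `upqTypeClasses ≠ ⊥ ⇒ κ = 0 ∧ σ = 0`, no irreducibility) and the organ's `ℤ`-spelling **`wχ_central_int_eq_zero`**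
  (`ρ𝔤 Z v = ((s:ℂ)·I) • v ⇒ s = 0`) — all over (b1)'s ★ `upqTypeClasses_eq_bot_of_upqCasimirOp_eq_smul` ∕ `…_of_center_eq_smul`;
* §3 («Cχ», desk D62-pre (c4)) CALIBRATION of the tree's normalisations on the NON-TRIVIAL family `det^m` (★ `UpqDeterminantCharacter`):
  **`upq_sum_sq_im_trace_upqKVec`** (`Σ_a (Im tr w_a)² = |α|+|β|` for the pseudo-orthonormal basis `(w_a)` of `𝔨` — dual-basis expansion of
  `i·1`, ★ `sum_apply_dualBasis_smul_basis`), hence (C1) **`upqDetCharCasimirScalar_eq_card_mul_sq`** (`c_m = (|α|+|β|)·m²`, closed form of ★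
  `upqDetCharCasimirScalar`), (C2) **`upqDetCharLie_apply_of_coe_eq_smul_one`** (`ρ𝔤(a·1) z = (m·(|α|+|β|)·a)·z`), and (C3) AT `U(2,1)` THE ORGAN'S
  TWO FORMULAS VERBATIM on `det^m` with HC parameter `(a,b,c) = (m+1, m, m−1)`: **`u21_detChar_chi`** —
  `(∀ v, upqCasimirOp (upqDetCharLie (Fin 2) (Fin 1) m) v = (((m+1)²+m²+(m−1)²−2 : ℤ) : ℂ) • v) ∧ ∀ Z, ↑Z = I • 1 → ∀ v, upqDetCharLie … m Z v =
  ((((m+1)+m+(m−1) : ℤ) : ℂ)·I) • v` — scale AND sign of `upqCasimirOp` ∕ centre vs «`C = ⟨λ+ρ,λ+ρ⟩ − ⟨ρ,ρ⟩`, `ρ = (1,0,−1)`» checked (`3m²`, `+3m·i`).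

HONEST LABEL.  Kit, count-neutral: nothing here restates or narrows #80; the print organ GLOBAL-ι^χ (the χ of `Π(ξ_ι)`) stays print.  HC_CM is
proved only modulo the 7 printed citations (2 remaining: hLiu418 = stmt-HodgeConjecture-24832, h413 = stmt-HodgeConjecture-24833) until rung 0 closes.

## References
* [BorelWallach2000] A. Borel, N. Wallach, *Continuous cohomology, discrete subgroups, and representations of reductive groups*, 2nd ed., AMS
  (2000) — I §5.1, §5.3 (Wigner's lemma; Thm. 5.3 (ii) for the centre of `𝔤`), II §1.1 (3)–(5), §1.3 (1)–(2) (the Casimir element), II Cor. 3.2–3.3.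
* [Rogawski1990] J. D. Rogawski, *Automorphic Representations of Unitary Groups in Three Variables*, Ann. of Math. Stud. 123 (1990) — §12.3
  pp. 174–178, Prop. 15.2.1 p. 249.
* [KnappVogan1995] A. W. Knapp, D. A. Vogan, *Cohomological Induction and Unitary Representations* (1995) — Prop. 4.87 (Dixmier's lemma).
* [Knapp2002] A. W. Knapp, *Lie Groups Beyond an Introduction*, 2nd ed. (2002) — Prop. 5.28 (`C = |λ+ρ|² − |ρ|²`).
-/

set_option autoImplicit false
set_option linter.dupNamespace false

noncomputable section

open scoped Matrix ComplexConjugate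

namespace Summit.HodgeConjecture.HodgeConjecture.Cruxes.H413.F0P3cWignerCasimirCentral

open Literature.Algebra.Lie
open Literature.NumberTheory.Automorphic
open Literature.RepresentationTheory.BorelWallach2000
open Literature.RepresentationTheory.KonnoKonno2007 Literature.RepresentationTheory.KonnoKonno2007.RealDualPair
open Literature.RepresentationTheory.KonnoKonno2007.RealDualPair.UForm
open Summit.HodgeConjecture.HodgeConjecture.Cruxes.H413.F0P2aL2cEngineDictionary (I_smul_one_mem_lie)

-- Mathlib idiom (as in `GKModules`, the `Upq*` files): the commutator bracket on `Module.End` ∕ matrices, to MENTION `ρ𝔤 : 𝔤 →ₗ⁅ℝ⁆ End V`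
attribute [local instance 100] LieRing.ofAssociativeRing

variable {α β : Type} [Fintype α] [DecidableEq α] [Fintype β] [DecidableEq β]

/-! ## §1 (W3) Schur read-backs on an irreducible module (Dixmier, no admissibility) -/

section Schur

variable {V : Type} [AddCommGroup V] [Module ℂ V]
  {ρK : Representation ℂ (uFormGroup α β).maximalCompact V} {ρ𝔤 : (uFormGroup α β).lie →ₗ⁅ℝ⁆ Module.End ℂ V}

/-- **W3 · a scalar element `Z = a·1 ∈ 𝔲(α, β)` acts by a scalar on an irreducible `(𝔤, K)`-module** (`algebraMap` form): `ρ𝔤 Z =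
algebraMap ℂ _ s` for some `s` (★ Dixmier–Schur `exists_eq_algebraMap_of_comm'`; `ρ𝔤 Z` commutes with `ρ𝔤(𝔤)` and `ρK(K)` because `Z` is central and
`Ad(K)`-fixed, ★ `GKCasimir.lie_comm𝔤` ∕ `lie_commK`). [cite: KnappVogan1995, Prop. 4.87] [cite: BorelWallach2000, I §5.3] -/
theorem wχ_exists_central_eq_algebraMap (hV : IsGKModule (uFormGroup α β) ρK ρ𝔤) (hirr : IsIrreducibleGK ρK ρ𝔤)
    {Z : (uFormGroup α β).lie} {a : ℂ} (hZ : (Z : Matrix (α ⊕ β) (α ⊕ β) ℂ) = a • (1 : Matrix (α ⊕ β) (α ⊕ β) ℂ)) :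
    ∃ s : ℂ, ρ𝔤 Z = algebraMap ℂ (Module.End ℂ V) s :=
  exists_eq_algebraMap_of_comm' hV hirr _
    (fun k => (GKCasimir.lie_commK (uFormGroup α β) ρK ρ𝔤 hV.ad_compat (fun k => upq_Ad_eq_self_of_coe_eq_smul_one hZ _) k).symm)
    (fun X => by
      rw [Module.End.mul_eq_comp, Module.End.mul_eq_comp]
      exact (GKCasimir.lie_comm𝔤 (uFormGroup α β) ρ𝔤 (upq_lie_eq_zero_of_coe_eq_smul_one hZ) X).symm)

/-- **W3 · pointwise**: on an irreducible `(𝔤, K)`-module of `U(α,β)` a scalar element `Z = a·1` acts by `ρ𝔤 Z v = s • v` for some `s ∈ ℂ`.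
[cite: KnappVogan1995, Prop. 4.87] [cite: BorelWallach2000, I §5.3] -/
theorem wχ_exists_central_scalar (hV : IsGKModule (uFormGroup α β) ρK ρ𝔤) (hirr : IsIrreducibleGK ρK ρ𝔤)
    {Z : (uFormGroup α β).lie} {a : ℂ} (hZ : (Z : Matrix (α ⊕ β) (α ⊕ β) ℂ) = a • (1 : Matrix (α ⊕ β) (α ⊕ β) ℂ)) :
    ∃ s : ℂ, ∀ v : V, ρ𝔤 Z v = s • v := by
  obtain ⟨s, hs⟩ := wχ_exists_central_eq_algebraMap hV hirr hZ
  exact ⟨s, fun v => by rw [hs, Module.algebraMap_end_apply]⟩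

/-- W3 at the generator `i·1` (the term `⟨Complex.I • 1, I_smul_one_mem_lie⟩` over ★ `F0P2aL2cEngineDictionary.I_smul_one_mem_lie`).
[cite: KnappVogan1995, Prop. 4.87] -/
theorem wχ_exists_scalarI_scalar (hV : IsGKModule (uFormGroup α β) ρK ρ𝔤) (hirr : IsIrreducibleGK ρK ρ𝔤) :
    ∃ s : ℂ, ∀ v : V, ρ𝔤 ⟨Complex.I • (1 : Matrix (α ⊕ β) (α ⊕ β) ℂ), I_smul_one_mem_lie⟩ v = s • v :=
  wχ_exists_central_scalar hV hirr (Z := ⟨Complex.I • 1, I_smul_one_mem_lie⟩) (a := Complex.I) rfl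

/-- **W3 · the Casimir acts by a scalar on an irreducible `(𝔤, K)`-module**, pointwise (★ `upqCasimirOp_eq_algebraMap_of_isIrreducibleGK`).
[cite: BorelWallach2000, II §3.1] [cite: KnappVogan1995, Prop. 4.87] -/
theorem wχ_exists_casimir_scalar (hV : IsGKModule (uFormGroup α β) ρK ρ𝔤) (hirr : IsIrreducibleGK ρK ρ𝔤) :
    ∃ c : ℂ, ∀ v : V, upqCasimirOp ρ𝔤 v = c • v := by
  obtain ⟨c, hc⟩ := upqCasimirOp_eq_algebraMap_of_isIrreducibleGK hV hirr
  exact ⟨c, fun v => by rw [hc, Module.algebraMap_end_apply]⟩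

end Schur

/-! ## §2 (W4) The χ-package: cohomology forces `χ = χ_𝟙` in χ-currency -/

section Package

variable {V : Type*} [AddCommGroup V] [Module ℂ V]
  (ρK : Representation ℂ (uFormGroup α β).maximalCompact V) (ρ𝔤 : (uFormGroup α β).lie →ₗ⁅ℝ⁆ Module.End ℂ V)

/-- **Scalar read-back form (no irreducibility)**: if `C_V = κ • id`, a scalar element `Z = a·1` acts by `σ • id`, and some
`upqTypeClasses … n δ ≠ ⊥`, then `κ = 0 ∧ σ = 0` (contrapositives of (b1)'s two vanishing theorems).
[cite: BorelWallach2000, I §5.3, Thm. 5.3 (ii); II Cor. 3.3] -/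
theorem wχ_scalars_eq_zero_of_typeClasses_ne_bot (hV : IsGKModule (uFormGroup α β) ρK ρ𝔤) {κ σ : ℂ}
    (hκ : ∀ v : V, upqCasimirOp ρ𝔤 v = κ • v)
    {Z : (uFormGroup α β).lie} {a : ℂ} (hZ : (Z : Matrix (α ⊕ β) (α ⊕ β) ℂ) = a • (1 : Matrix (α ⊕ β) (α ⊕ β) ℂ))
    (hσ : ∀ v : V, ρ𝔤 Z v = σ • v)
    {n : ℕ} {δ : ℤ} (h : upqTypeClasses ρK ρ𝔤 hV.ad_compat n δ ≠ ⊥) : κ = 0 ∧ σ = 0 := by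
  constructor
  · by_contra hκ0
    exact h (upqTypeClasses_eq_bot_of_upqCasimirOp_eq_smul ρK ρ𝔤 hV.ad_compat hκ0 hκ n δ)
  · by_contra hσ0
    exact h (upqTypeClasses_eq_bot_of_center_eq_smul ρK ρ𝔤 hV.ad_compat hZ hσ0 hσ n δ)

/-- **The Casimir scalar of a module with a non-zero `upqTypeClasses` is `0`.** [cite: BorelWallach2000, II Cor. 3.3; I §5.3] -/
theorem wχ_casimir_eq_zero (hV : IsGKModule (uFormGroup α β) ρK ρ𝔤) {κ : ℂ} (hκ : ∀ v : V, upqCasimirOp ρ𝔤 v = κ • v)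
    {n : ℕ} {δ : ℤ} (h : upqTypeClasses ρK ρ𝔤 hV.ad_compat n δ ≠ ⊥) : κ = 0 := by
  by_contra hκ0
  exact h (upqTypeClasses_eq_bot_of_upqCasimirOp_eq_smul ρK ρ𝔤 hV.ad_compat hκ0 hκ n δ)

/-- **The central scalar of a module with a non-zero `upqTypeClasses` is `0`** (`Z = a·1`). [cite: BorelWallach2000, I Thm. 5.3 (ii), §5.3] -/
theorem wχ_central_eq_zero (hV : IsGKModule (uFormGroup α β) ρK ρ𝔤)
    {Z : (uFormGroup α β).lie} {a : ℂ} (hZ : (Z : Matrix (α ⊕ β) (α ⊕ β) ℂ) = a • (1 : Matrix (α ⊕ β) (α ⊕ β) ℂ))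
    {σ : ℂ} (hσ : ∀ v : V, ρ𝔤 Z v = σ • v)
    {n : ℕ} {δ : ℤ} (h : upqTypeClasses ρK ρ𝔤 hV.ad_compat n δ ≠ ⊥) : σ = 0 := by
  by_contra hσ0
  exact h (upqTypeClasses_eq_bot_of_center_eq_smul ρK ρ𝔤 hV.ad_compat hZ hσ0 hσ n δ)

/-- **The organ's `ℤ`-spelling**: if a scalar element `Z = a·1` acts by `((s : ℂ) * I) • v` for an INTEGER `s` and some `upqTypeClasses … n δ ≠ ⊥`,
then `s = 0` (GLOBAL-ι^χ's clause «`∃ s : ℤ, (s = a+b+c ∨ s = −(a+b+c)) ∧ ∀ Z, ↑Z = I • 1 → ∀ v, σ𝔤 Z v = ((s:ℂ)·I) • v`» meets `H¹_δ ≠ ⊥`).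
[cite: BorelWallach2000, I Thm. 5.3 (ii)] [cite: Rogawski1990, §12.3 p. 178] -/
theorem wχ_central_int_eq_zero (hV : IsGKModule (uFormGroup α β) ρK ρ𝔤)
    {Z : (uFormGroup α β).lie} {a : ℂ} (hZ : (Z : Matrix (α ⊕ β) (α ⊕ β) ℂ) = a • (1 : Matrix (α ⊕ β) (α ⊕ β) ℂ))
    {s : ℤ} (hs : ∀ v : V, ρ𝔤 Z v = ((s : ℂ) * Complex.I) • v)
    {n : ℕ} {δ : ℤ} (h : upqTypeClasses ρK ρ𝔤 hV.ad_compat n δ ≠ ⊥) : s = 0 := by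
  have h0 : (s : ℂ) * Complex.I = 0 := wχ_central_eq_zero ρK ρ𝔤 hV hZ hs h
  rcases mul_eq_zero.1 h0 with h1 | h1
  · exact_mod_cast h1
  · exact absurd h1 Complex.I_ne_zero

end Package

section PackageIrred

variable {V : Type} [AddCommGroup V] [Module ℂ V]
  {ρK : Representation ℂ (uFormGroup α β).maximalCompact V} {ρ𝔤 : (uFormGroup α β).lie →ₗ⁅ℝ⁆ Module.End ℂ V}

/-- **W4 · THE χ-PACKAGE.**  An IRREDUCIBLE `(𝔤, K)`-module of `U(α, β)` with a non-zero `upqTypeClasses … n δ` (in particular with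
`H^n(𝔲(α,β), K; V) ≠ 0`) has VANISHING Casimir operator, and EVERY scalar element `Z = a·1` of `𝔲(α,β)` acts by ZERO — the two numerical
shadows of «`H^*(𝔤, K; V) ≠ 0 ⇒ χ_V = χ_𝟙`» (Wigner), with no model, no Harish-Chandra isomorphism, no unitarity and no admissibility.
[cite: BorelWallach2000, I §5.3, Thm. 5.3 (ii); II Cor. 3.3] [cite: Rogawski1990, Prop. 15.2.1 p. 249] -/
theorem wχ_casimir_and_central_eq_zero_of_typeClasses_ne_bot (hV : IsGKModule (uFormGroup α β) ρK ρ𝔤) (hirr : IsIrreducibleGK ρK ρ𝔤)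
    {n : ℕ} {δ : ℤ} (h : upqTypeClasses ρK ρ𝔤 hV.ad_compat n δ ≠ ⊥) :
    (∀ v : V, upqCasimirOp ρ𝔤 v = 0) ∧
      ∀ (Z : (uFormGroup α β).lie) (a : ℂ), (Z : Matrix (α ⊕ β) (α ⊕ β) ℂ) = a • (1 : Matrix (α ⊕ β) (α ⊕ β) ℂ) →
        ∀ v : V, ρ𝔤 Z v = 0 := by
  obtain ⟨c, hc⟩ := wχ_exists_casimir_scalar hV hirr
  have hc0 : c = 0 := wχ_casimir_eq_zero ρK ρ𝔤 hV hc h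
  refine ⟨fun v => by rw [hc, hc0, zero_smul], fun Z a hZ v => ?_⟩
  obtain ⟨s, hs⟩ := wχ_exists_central_scalar hV hirr hZ
  have hs0 : s = 0 := wχ_central_eq_zero ρK ρ𝔤 hV hZ hs h
  rw [hs, hs0, zero_smul]

end PackageIrred

/-! ## §3 («Cχ») Calibration of `upqCasimirOp` and of the centre on the family `det^m` -/

section Calibration

/-- `B(i·1, Y) = −Im tr Y` for the trace form `B = Re tr(XY)` of `𝔲(α, β)`. [cite: BorelWallach2000, II §1.1 (4)–(5)] -/
theorem upqTraceForm_scalarI_left (Y : (uFormGroup α β).lie) :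
    upqTraceForm α β ⟨Complex.I • (1 : Matrix (α ⊕ β) (α ⊕ β) ℂ), I_smul_one_mem_lie⟩ Y =
      -((Y : Matrix (α ⊕ β) (α ⊕ β) ℂ).trace).im := by
  rw [upqTraceForm_apply]
  change ((Complex.I • (1 : Matrix (α ⊕ β) (α ⊕ β) ℂ)) * (Y : Matrix (α ⊕ β) (α ⊕ β) ℂ)).trace.re = _
  rw [Matrix.smul_mul, Matrix.one_mul, Matrix.trace_smul, smul_eq_mul, Complex.I_mul_re]

/-- `B(i·1, i·1) = −(|α| + |β|)`. [cite: BorelWallach2000, II §1.1 (4)–(5)] -/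
theorem upqTraceForm_scalarI_scalarI :
    upqTraceForm α β ⟨Complex.I • (1 : Matrix (α ⊕ β) (α ⊕ β) ℂ), I_smul_one_mem_lie⟩
        ⟨Complex.I • (1 : Matrix (α ⊕ β) (α ⊕ β) ℂ), I_smul_one_mem_lie⟩ =
      -((Fintype.card α + Fintype.card β : ℕ) : ℝ) := by
  rw [upqTraceForm_scalarI_left]
  change -((Complex.I • (1 : Matrix (α ⊕ β) (α ⊕ β) ℂ)).trace).im = _
  rw [Matrix.trace_smul, Matrix.trace_one, smul_eq_mul, Complex.I_mul_im, Fintype.card_sum]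
  simp

/-- **`Σ_a (Im tr w_a)² = |α| + |β|`** for the pseudo-orthonormal basis `(w_a)` of `𝔨` (★ `upqKVec`): expand `Z = i·1 = Σ_t B(Z, y'_t) y_t` in the
basis ★ `upqBasis` (★ `sum_apply_dualBasis_smul_basis`) and pair with `Z`: `B(Z,Z) = −(|α|+|β|)`, while `B(Z, x_s) = 0` (`tr x_s = 0`),
`B(Z, w_a) = −Im tr w_a`, `y'_{w_a} = −w_a`.  The missing evaluation behind ★ `upqDetCharCasimirScalar_eq`.
[cite: BorelWallach2000, II §1.1 (5), §1.3 (2); II Cor. 3.2] -/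
theorem upq_sum_sq_im_trace_upqKVec :
    ∑ a, (((upqKVec α β a : (uFormGroup α β).lie) : Matrix (α ⊕ β) (α ⊕ β) ℂ).trace.im) ^ 2 =
      ((Fintype.card α + Fintype.card β : ℕ) : ℝ) := by
  set Z : (uFormGroup α β).lie := ⟨Complex.I • (1 : Matrix (α ⊕ β) (α ⊕ β) ℂ), I_smul_one_mem_lie⟩ with hZdef
  have hexp := sum_apply_dualBasis_smul_basis upqTraceForm_nondegenerate upqTraceForm_isSymm (upqBasis α β) Z
  -- pair the expansion with `Z`
  have hBZZ : upqTraceForm α β Z Z =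
      ∑ t, upqTraceForm α β Z ((upqTraceForm α β).dualBasis upqTraceForm_nondegenerate (upqBasis α β) t) *
        upqTraceForm α β Z (upqBasis α β t) := by
    have h := congrArg (fun W => upqTraceForm α β Z W) hexp
    simp only [map_sum, map_smul, smul_eq_mul] at h
    exact h.symm
  -- evaluate each term
  have hdual : ∀ t, (upqTraceForm α β).dualBasis upqTraceForm_nondegenerate (upqBasis α β) t = upqDualBasis α β t := fun _ => rfl
  rw [Fintype.sum_sum_type] at hBZZ
  have hP : ∀ s : (α × β) × Fin 2, upqTraceForm α β Z (upqBasis α β (Sum.inl s)) = 0 := fun s => by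
    rw [coe_upqBasis, upqVec, Sum.elim_inl, hZdef, upqTraceForm_scalarI_left, upq_trace_upqPBasis, Complex.zero_im, neg_zero]
  have hK : ∀ a : Fin (upqKDim α β), upqTraceForm α β Z (upqBasis α β (Sum.inr a)) =
      -(((upqKVec α β a : (uFormGroup α β).lie) : Matrix (α ⊕ β) (α ⊕ β) ℂ).trace.im) := fun a => by
    rw [coe_upqBasis, upqVec, Sum.elim_inr, hZdef, upqTraceForm_scalarI_left]
  have hKd : ∀ a : Fin (upqKDim α β), upqTraceForm α β Z ((upqTraceForm α β).dualBasis upqTraceForm_nondegenerate (upqBasis α β) (Sum.inr a)) =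
      (((upqKVec α β a : (uFormGroup α β).lie) : Matrix (α ⊕ β) (α ⊕ β) ℂ).trace.im) := fun a => by
    rw [hdual, upqDualBasis_inr, map_neg, hZdef, upqTraceForm_scalarI_left, neg_neg]
  simp only [hP, mul_zero, Finset.sum_const_zero, zero_add, hKd, hK, mul_neg, Finset.sum_neg_distrib] at hBZZ
  rw [hZdef, upqTraceForm_scalarI_scalarI, neg_inj] at hBZZ
  rw [hBZZ]
  exact Finset.sum_congr rfl fun a _ => by ring

variable (α β) in
/-- **(C1) `c_m = (|α| + |β|) · m²`** — the closed form of the Casimir scalar ★ `upqDetCharCasimirScalar α β m` of `det^m` on `U(α, β)`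
(★ `upqDetCharCasimirScalar_eq`: `c_m = m² Σ_a (Im tr w_a)²`, and `Σ_a (Im tr w_a)² = |α|+|β|`). [cite: BorelWallach2000, II Cor. 3.2; II §1.3 (2)] -/
theorem upqDetCharCasimirScalar_eq_card_mul_sq (m : ℤ) :
    upqDetCharCasimirScalar α β m = ((Fintype.card α + Fintype.card β : ℕ) : ℂ) * (m : ℂ) ^ 2 := by
  rw [upqDetCharCasimirScalar_eq, upq_sum_sq_im_trace_upqKVec]
  push_cast
  ring

variable (α β) in
/-- (C1) operator form: `C_V v = ((|α|+|β|)·m²) • v` on `det^m`. [cite: BorelWallach2000, II Cor. 3.2; II §1.3 (2)] -/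
theorem upqDetChar_casimir_eq_card_mul_sq (m : ℤ) (v : ℂ) :
    upqCasimirOp (upqDetCharLie α β m) v = (((Fintype.card α + Fintype.card β : ℕ) : ℂ) * (m : ℂ) ^ 2) • v := by
  rw [upqDetChar_casimir, upqDetCharCasimirScalar_eq_card_mul_sq]

variable (α β) in
/-- **(C2) the centre on `det^m`**: a scalar element `Z = a·1` acts on `det^m` by `(m · (|α|+|β|) · a) · z` (★ `upqDetCharLie_apply`, `tr(a·1) =
(|α|+|β|)·a`). [cite: BorelWallach2000, I §5.1] -/
theorem upqDetCharLie_apply_of_coe_eq_smul_one (m : ℤ) {Z : (uFormGroup α β).lie} {a : ℂ}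
    (hZ : (Z : Matrix (α ⊕ β) (α ⊕ β) ℂ) = a • (1 : Matrix (α ⊕ β) (α ⊕ β) ℂ)) (z : ℂ) :
    upqDetCharLie α β m Z z = ((m : ℂ) * ((Fintype.card α + Fintype.card β : ℕ) : ℂ) * a) * z := by
  rw [upqDetCharLie_apply, hZ, Matrix.trace_smul, Matrix.trace_one, smul_eq_mul, Fintype.card_sum]
  ring

/-- **(C3) CALIBRATION AT `U(2,1)` — the organ GLOBAL-ι^χ's two formulas VERBATIM on `det^m`**, whose Harish-Chandra parameter is
`(a,b,c) = (m+1, m, m−1)` (highest weight `(m,m,m)` plus `ρ = (1,0,−1)`): the tree's Casimir acts by `κ(m+1,m,m−1) = (m+1)²+m²+(m−1)²−2 = 3m²` and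
the centre `i·1` by `+i·e₁(m+1,m,m−1) = 3m·i` — SCALE and SIGN of ★ `upqCasimirOp` ∕ `σ𝔤(i·1)` against «`C = ⟨λ+ρ,λ+ρ⟩ − ⟨ρ,ρ⟩`» on a non-trivial family
(`m = 0` is the trivial module, ★ `upqDetCharCasimirScalar_zero`). [cite: BorelWallach2000, II Cor. 3.2; I §5.1] [cite: Knapp2002, Prop. 5.28]
[cite: Rogawski1990, §12.3 p. 178] -/
theorem u21_detChar_chi (m : ℤ) :
    (∀ v : ℂ, upqCasimirOp (upqDetCharLie (Fin 2) (Fin 1) m) v = (((m + 1) ^ 2 + m ^ 2 + (m - 1) ^ 2 - 2 : ℤ) : ℂ) • v) ∧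
      ∀ Z : (uFormGroup (Fin 2) (Fin 1)).lie, (Z : Matrix (Fin 2 ⊕ Fin 1) (Fin 2 ⊕ Fin 1) ℂ) = Complex.I • 1 →
        ∀ v : ℂ, upqDetCharLie (Fin 2) (Fin 1) m Z v = ((((m + 1) + m + (m - 1) : ℤ) : ℂ) * Complex.I) • v := by
  refine ⟨fun v => ?_, fun Z hZ v => ?_⟩
  · rw [upqDetChar_casimir_eq_card_mul_sq]
    congr 1
    simp only [Fintype.card_fin]
    push_cast
    ring
  · rw [upqDetCharLie_apply_of_coe_eq_smul_one (Fin 2) (Fin 1) m hZ, smul_eq_mul]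
    simp only [Fintype.card_fin]
    push_cast
    ring

/-- (C3), in the organ's `∃ s`-shape: `s := (m+1) + m + (m−1)` witnesses the central clause on `det^m` with the `+` sign.
[cite: BorelWallach2000, I §5.1] [cite: Rogawski1990, §12.3 p. 178] -/
theorem u21_detChar_central_clause (m : ℤ) :
    ∃ s : ℤ, (s = (m + 1) + m + (m - 1) ∨ s = -((m + 1) + m + (m - 1))) ∧
      ∀ Z : (uFormGroup (Fin 2) (Fin 1)).lie, (Z : Matrix (Fin 2 ⊕ Fin 1) (Fin 2 ⊕ Fin 1) ℂ) = Complex.I • 1 →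
        ∀ v : ℂ, upqDetCharLie (Fin 2) (Fin 1) m Z v = (((s : ℤ) : ℂ) * Complex.I) • v :=
  ⟨(m + 1) + m + (m - 1), Or.inl rfl, (u21_detChar_chi m).2⟩

/-- (C3) at `m = 1` spelled out: on `det` the Casimir acts by `3` and `i·1` by `3i` (so neither clause of GLOBAL-ι^χ is vacuous: the wrong triple
`(1,0,−1)` would demand `0` and `0`). [cite: BorelWallach2000, II Cor. 3.2] [cite: Knapp2002, Prop. 5.28] -/
theorem u21_det_chi :
    (∀ v : ℂ, upqCasimirOp (upqDetCharLie (Fin 2) (Fin 1) 1) v = (3 : ℂ) • v) ∧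
      ∀ Z : (uFormGroup (Fin 2) (Fin 1)).lie, (Z : Matrix (Fin 2 ⊕ Fin 1) (Fin 2 ⊕ Fin 1) ℂ) = Complex.I • 1 →
        ∀ v : ℂ, upqDetCharLie (Fin 2) (Fin 1) 1 Z v = (3 * Complex.I) • v := by
  obtain ⟨h1, h2⟩ := u21_detChar_chi 1
  refine ⟨fun v => ?_, fun Z hZ v => ?_⟩
  · rw [h1 v]; norm_num
  · rw [h2 Z hZ v]; norm_num

end Calibration

end Summit.HodgeConjecture.HodgeConjecture.Cruxes.H413.F0P3cWignerCasimirCentral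

end
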